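import Summits.QuantumFields.BalabanUV.Beta.EriceFlowEnclosureBorelTransformTaylor

/-!
# Beta / EriceFlowEnclosureBorelTransformStrip — NEVANLINNA'S CONTINUATION TO THE STRIP: gluing the Taylor discs of 36d along `ℝ₊`,
# the Bromwich integral `J` (real `t > 0`) extends to a function `𝒥(τ) = T_{Re τ}(τ)` HOLOMORPHIC on the half-strip
# `{Re τ > 0, |Im τ| < 1∕K}`, equal to `J` on `ℝ₊`, with `‖𝒥(τ)‖ ≤ 2πC·L(Re τ)·S(θ)` on `|Im τ| ≤ θ∕K` — exponential type in `Re τ`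
# (bflow-p3 gen 39, exploratory MODULE 36e over 36d; Mathlib + tree only)

HONEST FRAMING (page 1 of everything the β sub-cell writes): discharging `BetaPertH` makes Bałaban's UV stability UNCONDITIONAL — a
real constructive-QFT result; it is NOT the continuum limit and NOT the Clay problem.  HONEST DEPENDENCY (cell reorg 2026-08-19,
verbatim): «continuum YM on T⁴ ⇐ BetaPertH ∧ nine spine estimates (0/9 proved); BetaPertH ⇐ (D1) ∧ (D4) ∧ CAP+tail; G-an2-4 gates
asym, D1 and NE2/3/4.»  THIS MODULE DISCHARGES NOTHING: [folklore] one-variable analysis over Mathlib (no β-function, no flow, no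
Erice sentence is used).

SOURCE (shapes only).  [Rivasseau1991] Thm I.5.1 pp. 55–56 (analytic continuation in the strip S_σ = {t | dist(t, ℝ⁺) < 1∕σ},
|B(t)| ≤ const·e^{|t|∕R} — our condensation); [LodayRichaud2016] Thm 5.3.9 (ii)⇒(i) pp. 158–163.

WHAT THIS FILE PROVES (0 sorry, 0 def).  With `𝒥(τ) := Σ_k J^{(k)}(Re τ)·(τ − Re τ)^k∕k!`: `strip_eq_taylor_nhds` (near every point of the
half-strip `𝒥` coincides with ONE Taylor disc), HEADLINE **`differentiableOn_strip`** (`𝒥` holomorphic on `{0 < Re τ, |Im τ| < K⁻¹}`),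
`strip_ofReal` (`𝒥(t) = J(t)`, `t > 0`), **`norm_strip_le`** (`‖𝒥 τ‖ ≤ 2πC·L(Re τ)·S(θ)` for `|Im τ| ≤ θ∕K`, `L(t) = 1 + Kt + e^{ct}K²∕(2c²)`).
-/

namespace Summit.QuantumFields.BalabanUV.Beta.EriceFlowEnclosureBorelTransformStrip

open Set Filter Topology MeasureTheory Metric Complex
open scoped Real Nat
open Summit.QuantumFields.BalabanUV.Beta.EriceFlowEnclosureBorelTransformTaylor

noncomputable section

/-- **Near every point of the half-strip the glued function IS one Taylor disc**: for `τ₀` with `Re τ₀ > 0`, `|Im τ₀| < 1∕K`, on a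
neighbourhood of `τ₀`: `T_{Re τ}(τ) = T_{Re τ₀}(τ)` (36d `taylor_agree` at the centres `Re τ`, `Re τ₀`). [folklore] -/
theorem strip_eq_taylor_nhds {G : ℂ → ℂ} {a : ℕ → ℂ} {c₀ c C K : ℝ} (hc₀ : 0 < c₀) (hc : c₀ < c)
    (hC : 0 ≤ C) (hK : 0 < K) (hG : DifferentiableOn ℂ G {w : ℂ | c₀ < w.re})
    (hrem : ∀ N : ℕ, 1 ≤ N → ∀ w : ℂ, c₀ < w.re →
      ‖G w - ∑ n ∈ Finset.Ico 1 N, a n * (1 / w ^ (n + 1))‖ ≤ C * K ^ N * N ! / ‖w‖ ^ (N + 1))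
    (ha : ∀ n : ℕ, ‖a n‖ ≤ C * K ^ n * n !) {τ₀ : ℂ} (hτ₀ : 0 < τ₀.re ∧ |τ₀.im| < K⁻¹) :
    ∀ᶠ τ in 𝓝 τ₀,
      (∑' k : ℕ, iteratedDeriv k (fun t : ℝ => ∫ s : ℝ, cexp ((t : ℂ) * ((c : ℂ) + (s : ℂ) * I)) * G ((c : ℂ) + (s : ℂ) * I))
          τ.re * ((τ - (τ.re : ℂ)) ^ k / (k ! : ℂ))) =
      ∑' k : ℕ, iteratedDeriv k (fun t : ℝ => ∫ s : ℝ, cexp ((t : ℂ) * ((c : ℂ) + (s : ℂ) * I)) * G ((c : ℂ) + (s : ℂ) * I))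
          τ₀.re * ((τ - (τ₀.re : ℂ)) ^ k / (k ! : ℂ)) := by
  -- a small radius `ε` with `2ε + |Im τ₀| < K⁻¹` and `ε < Re τ₀`
  set ε : ℝ := min (τ₀.re / 2) ((K⁻¹ - |τ₀.im|) / 3) with hε
  have hεpos : 0 < ε := lt_min (by linarith [hτ₀.1]) (by linarith [hτ₀.2])
  have hε1 : ε ≤ τ₀.re / 2 := min_le_left _ _
  have hε2 : ε ≤ (K⁻¹ - |τ₀.im|) / 3 := min_le_right _ _
  filter_upwards [Metric.ball_mem_nhds τ₀ hεpos] with τ hτ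
  rw [mem_ball, dist_eq_norm] at hτ
  have hre : |τ.re - τ₀.re| < ε := by
    calc |τ.re - τ₀.re| = |(τ - τ₀).re| := by simp
      _ ≤ ‖τ - τ₀‖ := Complex.abs_re_le_norm _
      _ < ε := hτ
  have him : |τ.im - τ₀.im| < ε := by
    calc |τ.im - τ₀.im| = |(τ - τ₀).im| := by simp
      _ ≤ ‖τ - τ₀‖ := Complex.abs_im_le_norm _
      _ < ε := hτ
  have hτre : 0 < τ.re := by
    have := (abs_lt.mp hre).1; linarith [hτ₀.1]
  have hclose : |τ₀.re - τ.re| < K⁻¹ := by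
    rw [abs_sub_comm]; linarith [abs_nonneg τ₀.im]
  -- `τ` lies in both discs
  have hin1 : τ ∈ ball ((τ.re : ℂ)) K⁻¹ := by
    rw [mem_ball, dist_eq_norm]
    have e : τ - (τ.re : ℂ) = (τ.im : ℂ) * I := by
      apply Complex.ext <;> simp
    rw [e, norm_mul, Complex.norm_real, Complex.norm_I, mul_one, Real.norm_eq_abs]
    calc |τ.im| = |τ₀.im + (τ.im - τ₀.im)| := by ring_nf
      _ ≤ |τ₀.im| + |τ.im - τ₀.im| := abs_add_le _ _
      _ < |τ₀.im| + ε := by linarith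
      _ < K⁻¹ := by linarith [abs_nonneg τ₀.im]
  have hin0 : τ ∈ ball ((τ₀.re : ℂ)) K⁻¹ := by
    rw [mem_ball, dist_eq_norm]
    have e : τ₀ - (τ₀.re : ℂ) = (τ₀.im : ℂ) * I := by apply Complex.ext <;> simp
    have hn0 : ‖τ₀ - (τ₀.re : ℂ)‖ = |τ₀.im| := by
      rw [e, norm_mul, Complex.norm_real, Complex.norm_I, mul_one, Real.norm_eq_abs]
    calc ‖τ - (τ₀.re : ℂ)‖ ≤ ‖τ - τ₀‖ + ‖τ₀ - (τ₀.re : ℂ)‖ := norm_sub_le_norm_sub_add_norm_sub _ _ _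
      _ = ‖τ - τ₀‖ + |τ₀.im| := by rw [hn0]
      _ < ε + |τ₀.im| := by linarith
      _ < K⁻¹ := by linarith [abs_nonneg τ₀.im]
  exact taylor_agree hc₀ hc hC hK hG hrem ha hτre hτ₀.1 hclose ⟨hin1, hin0⟩

/-- **THE GLUED TAYLOR DISCS ARE HOLOMORPHIC ON THE HALF-STRIP `{Re τ > 0, |Im τ| < 1∕K}`.** [cite: Rivasseau1991, Thm I.5.1]
[cite: LodayRichaud2016, Thm 5.3.9 (ii)⇒(i)] -/
theorem differentiableOn_strip {G : ℂ → ℂ} {a : ℕ → ℂ} {c₀ c C K : ℝ} (hc₀ : 0 < c₀) (hc : c₀ < c)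
    (hC : 0 ≤ C) (hK : 0 < K) (hG : DifferentiableOn ℂ G {w : ℂ | c₀ < w.re})
    (hrem : ∀ N : ℕ, 1 ≤ N → ∀ w : ℂ, c₀ < w.re →
      ‖G w - ∑ n ∈ Finset.Ico 1 N, a n * (1 / w ^ (n + 1))‖ ≤ C * K ^ N * N ! / ‖w‖ ^ (N + 1))
    (ha : ∀ n : ℕ, ‖a n‖ ≤ C * K ^ n * n !) :
    DifferentiableOn ℂ (fun τ : ℂ => ∑' k : ℕ,
      iteratedDeriv k (fun t : ℝ => ∫ s : ℝ, cexp ((t : ℂ) * ((c : ℂ) + (s : ℂ) * I)) * G ((c : ℂ) + (s : ℂ) * I)) τ.re *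
        ((τ - (τ.re : ℂ)) ^ k / (k ! : ℂ))) {τ : ℂ | 0 < τ.re ∧ |τ.im| < K⁻¹} := by
  intro τ₀ hτ₀
  have hev := strip_eq_taylor_nhds hc₀ hc hC hK hG hrem ha hτ₀
  have hT := differentiableOn_taylor hc₀ hc hC hK hG hrem ha hτ₀.1
  have hmem : τ₀ ∈ ball ((τ₀.re : ℂ)) K⁻¹ := by
    rw [mem_ball, dist_eq_norm]
    have e : τ₀ - (τ₀.re : ℂ) = (τ₀.im : ℂ) * I := by apply Complex.ext <;> simp
    rw [e, norm_mul, Complex.norm_real, Complex.norm_I, mul_one, Real.norm_eq_abs]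
    exact hτ₀.2
  have hAt : DifferentiableAt ℂ (fun τ : ℂ => ∑' k : ℕ,
      iteratedDeriv k (fun t : ℝ => ∫ s : ℝ, cexp ((t : ℂ) * ((c : ℂ) + (s : ℂ) * I)) * G ((c : ℂ) + (s : ℂ) * I)) τ₀.re *
        ((τ - (τ₀.re : ℂ)) ^ k / (k ! : ℂ))) τ₀ :=
    hT.differentiableAt (isOpen_ball.mem_nhds hmem)
  exact ((Filter.EventuallyEq.differentiableAt_iff hev).mpr hAt).differentiableWithinAt

/-- **On the real half-line the glued function is the Bromwich integral**: `𝒥(t) = J(t)` for `t > 0`. [folklore] -/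
theorem strip_ofReal {G : ℂ → ℂ} {a : ℕ → ℂ} {c₀ c C K : ℝ} (hc₀ : 0 < c₀) (hc : c₀ < c)
    (hC : 0 ≤ C) (hK : 0 < K) (hG : DifferentiableOn ℂ G {w : ℂ | c₀ < w.re})
    (hrem : ∀ N : ℕ, 1 ≤ N → ∀ w : ℂ, c₀ < w.re →
      ‖G w - ∑ n ∈ Finset.Ico 1 N, a n * (1 / w ^ (n + 1))‖ ≤ C * K ^ N * N ! / ‖w‖ ^ (N + 1))
    (ha : ∀ n : ℕ, ‖a n‖ ≤ C * K ^ n * n !) {t : ℝ} (ht : 0 < t) :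
    (∑' k : ℕ, iteratedDeriv k (fun t : ℝ => ∫ s : ℝ, cexp ((t : ℂ) * ((c : ℂ) + (s : ℂ) * I)) * G ((c : ℂ) + (s : ℂ) * I))
        ((t : ℂ)).re * ((((t : ℂ)) - ((((t : ℂ)).re : ℝ) : ℂ)) ^ k / (k ! : ℂ))) =
      ∫ s : ℝ, cexp ((t : ℂ) * ((c : ℂ) + (s : ℂ) * I)) * G ((c : ℂ) + (s : ℂ) * I) := by
  have h := hasSum_taylor_real hc₀ hc hC hK hG hrem ha ht le_rfl (by simp)
  simp only [Complex.ofReal_re]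
  exact h.tsum_eq

/-- **EXPONENTIAL TYPE IN THE STRIP**: for `Re τ > 0` and `|Im τ| ≤ θ∕K` (`0 ≤ θ < 1`):
`‖𝒥(τ)‖ ≤ 2πC·(1 + K·Re τ + e^{c·Re τ}K²∕(2c²))·Σ_k (6k²+2)θ^k`. [cite: Rivasseau1991, Thm I.5.1] -/
theorem norm_strip_le {G : ℂ → ℂ} {a : ℕ → ℂ} {c₀ c C K : ℝ} (hc₀ : 0 < c₀) (hc : c₀ < c)
    (hC : 0 ≤ C) (hK : 0 < K) (hG : DifferentiableOn ℂ G {w : ℂ | c₀ < w.re})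
    (hrem : ∀ N : ℕ, 1 ≤ N → ∀ w : ℂ, c₀ < w.re →
      ‖G w - ∑ n ∈ Finset.Ico 1 N, a n * (1 / w ^ (n + 1))‖ ≤ C * K ^ N * N ! / ‖w‖ ^ (N + 1))
    (ha : ∀ n : ℕ, ‖a n‖ ≤ C * K ^ n * n !) {θ : ℝ} (hθ0 : 0 ≤ θ) (hθ1 : θ < 1) {τ : ℂ} (hτ : 0 < τ.re)
    (hτi : |τ.im| ≤ θ / K) :
    ‖∑' k : ℕ, iteratedDeriv k (fun t : ℝ => ∫ s : ℝ, cexp ((t : ℂ) * ((c : ℂ) + (s : ℂ) * I)) * G ((c : ℂ) + (s : ℂ) * I))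
        τ.re * ((τ - (τ.re : ℂ)) ^ k / (k ! : ℂ))‖ ≤
      2 * π * C * (1 + K * τ.re + Real.exp (c * τ.re) * K ^ 2 / (2 * c ^ 2)) * ∑' k : ℕ, (6 * (k : ℝ) ^ 2 + 2) * θ ^ k := by
  have hn : ‖τ - (τ.re : ℂ)‖ ≤ θ / K := by
    have e : τ - (τ.re : ℂ) = (τ.im : ℂ) * I := by apply Complex.ext <;> simp
    rw [e, norm_mul, Complex.norm_real, Complex.norm_I, mul_one, Real.norm_eq_abs]
    exact hτi
  exact norm_taylor_le hc₀ hc hC hK hG hrem ha hτ hθ0 hθ1 hn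

end

end Summit.QuantumFields.BalabanUV.Beta.EriceFlowEnclosureBorelTransformStrip
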